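import Summits.AnomalousDissipation.AnomalousDissipation.Theorems.DenseLoudDesignerForces.Negative.BandLimited
import Literature.Analysis.FunctionSpaces.TorusFourierConvolution
import Literature.Analysis.FluidPDE.EulerReynolds

/-!
# Negative knowledge for the crux `DenseLoudDesignerForces` (stmt-AnomalousDissipation-1143), VIII: scale covariance
# and the Grashof (unit-viscosity) form

Certified copy of §10 of the cdisprove work file: parabolic time rescaling of global classical orbits
(`timeRescale`), `meanEnergy ↦ λ²`, `meanDissipation ↦ λ³`, linearity `force S (a • c) = a • force S c`,
`loudAt_iff_timeRescale`, and `mem_loudSet_iff_unit_viscosity` (the loud sets at unit viscosity with Grashof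
scaling of the budgets).  Supports stmt-AnomalousDissipation-1143.
-/

noncomputable section

namespace Summit.AnomalousDissipation.AnomalousDissipation.Theorems.DenseLoudDesignerForces.Negative

open scoped BigOperators Topology ENNReal InnerProductSpace
open Filter Set MeasureTheory UnitAddTorus
open Literature.Analysis.FunctionSpaces Literature.Analysis.FluidPDE
open Summit.AnomalousDissipation.AnomalousDissipation.Theses.BaireTransfer

/-! ## §10 Scale covariance: the crux at unit viscosity (Grashof form)

The parabolic scaling `(u,p)(t,x) ↦ (λu, λ²p)(λt,x)` maps classical `τ`-periodic orbits of NS_ν forced by `f_c`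
to `τ/λ`-periodic orbits of NS_{λν} forced by `f_{λ²c}`, with `meanEnergy ↦ λ²·`, `meanDissipation ↦ λ³·`.
Hence LOUDNESS IS SCALE-COVARIANT (`loudAt_timeRescale`) and the crux has a UNIT-VISCOSITY (Grashof) form
(`mem_loudSet_iff_unit_viscosity`): `c ∈ LOUD_j(S,E,ε)` iff for some `ν < 1/(j+1)` the force `ν⁻²c`
carries, at viscosity ONE, a periodic classical orbit with energy `≤ E/ν²` and dissipation `≥ ε/ν³` — the
Kolmogorov scalings `U² ~ G`, `ε ~ G^{3/2}` in the Grashof number `G ~ ‖c‖/ν²`: the crux says that the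
dissipation coefficient `β = ε/U³` of SOME periodic orbit stays `≥ β₀` as `G → ∞`, along a dense set of force
directions near `U`.  Conversely no single moderate-`ν` loud orbit propagates down the levels: rescaling it
trades `ε ↦ λ³ε → 0` (no trivialisation by symmetry). -/

section Scaling

variable {ν lam τ : ℝ} {F : (UnitAddTorus (Fin 3)) → (EuclideanSpace ℝ (Fin 3))} {u : ℝ → (UnitAddTorus (Fin 3)) → (EuclideanSpace ℝ (Fin 3))} {p : ℝ → (UnitAddTorus (Fin 3)) → ℝ}

/-- PARABOLIC TIME RESCALING of a global classical solution with steady force: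
`(u,p) ↦ (λu(λ·), λ²p(λ·))` solves NS with viscosity `λν` and force `λ²F` (any real `λ`; `λ > 0` is the
physical case, `λ < 0` composes it with time reversal `ν ↦ -ν`). -/
theorem timeRescale (h : Torus.IsClassicalNSSolutionOn univ ν (fun _ => F) u p) (lam : ℝ) :
    Torus.IsClassicalNSSolutionOn univ (lam * ν) (fun _ => lam ^ 2 • F) (fun t x => lam • u (lam * t) x)
      (fun t x => lam ^ 2 * p (lam * t) x) where
  smooth_velocity := by
    have hφ : ContDiff ℝ ((⊤ : ℕ∞) : WithTop ℕ∞) (fun z : ℝ × EuclideanSpace ℝ (Fin 3) => ((lam * z.1, z.2) : ℝ × EuclideanSpace ℝ (Fin 3))) :=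
      (contDiff_const.mul contDiff_fst).prodMk contDiff_snd
    have h1 : Torus.IsSmoothSpaceTimeOn univ (fun t x => u (lam * t) x) :=
      h.smooth_velocity.comp hφ.contDiffOn (fun z _ => mk_mem_prod (mem_univ _) (mem_univ _))
    exact h1.const_smul lam
  smooth_pressure := by
    have hφ : ContDiff ℝ ((⊤ : ℕ∞) : WithTop ℕ∞) (fun z : ℝ × EuclideanSpace ℝ (Fin 3) => ((lam * z.1, z.2) : ℝ × EuclideanSpace ℝ (Fin 3))) :=
      (contDiff_const.mul contDiff_fst).prodMk contDiff_snd
    have h1 : Torus.IsSmoothSpaceTimeOn univ (fun t x => p (lam * t) x) :=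
      h.smooth_pressure.comp hφ.contDiffOn (fun z _ => mk_mem_prod (mem_univ _) (mem_univ _))
    have := h1.const_smul (lam ^ 2)
    simpa only [smul_eq_mul] using this
  momentum t _ x := by
    have hus : Torus.IsSmooth (u (lam * t)) := h.smooth_velocity.isSmooth_slice (mem_univ _)
    have hps : Torus.IsSmooth (p (lam * t)) := h.smooth_pressure.isSmooth_slice (mem_univ _)
    have h1 : Torus.timeDerivWithin univ (fun t x => lam • u (lam * t) x) t x =
        lam • (lam • Torus.timeDerivWithin univ u (lam * t) x) := by
      have hg : HasDerivWithinAt (fun s => u s x) (Torus.timeDerivWithin univ u (lam * t) x) univ (lam * t) :=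
        h.smooth_velocity.hasDerivWithinAt_slice (mem_univ _) x
      have hh : HasDerivWithinAt (fun s : ℝ => lam * s) lam univ t := by
        simpa using (hasDerivWithinAt_id t univ).const_mul lam
      have hcomp := (hg.scomp t hh (mapsTo_univ _ _)).const_smul lam
      exact hcomp.derivWithin (uniqueDiffOn_univ t (mem_univ t))
    have h2 : Torus.convect (fun x => lam • u (lam * t) x) (fun x => lam • u (lam * t) x) x =
        lam • (lam • Torus.convect (u (lam * t)) (u (lam * t)) x) := by
      change Torus.fderiv (lam • u (lam * t)) x (lam • u (lam * t) x) = _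
      rw [Torus.fderiv_const_smul (hus.isContDiff (by simp)), FunLike.coe_smul, Pi.smul_apply,
        map_smul]
      rfl
    have h3 : Torus.gradient (fun x => lam ^ 2 * p (lam * t) x) x = lam ^ 2 • Torus.gradient (p (lam * t)) x := by
      change Torus.gradient (lam ^ 2 • p (lam * t)) x = _
      exact Torus.gradient_const_smul (hps.isContDiff (by simp)) _ _
    have h4 : Torus.laplacian (fun x => lam • u (lam * t) x) x = lam • Torus.laplacian (u (lam * t)) x := by
      change Torus.laplacian (lam • u (lam * t)) x = _
      exact Torus.laplacian_const_smul_apply hus lam x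
    have hm := h.momentum (lam * t) (mem_univ _) x
    have e1 : lam * ν * lam = lam * lam * ν := by ring
    rw [h1, h2, h3, h4, smul_smul, smul_smul, ← smul_add, hm, smul_add, smul_sub, smul_smul, smul_smul, e1, pow_two,
      Pi.smul_apply]
  divFree t _ x := by
    have hus : Torus.IsSmooth (u (lam * t)) := h.smooth_velocity.isSmooth_slice (mem_univ _)
    change Torus.divergence (lam • u (lam * t)) x = 0
    rw [Torus.divergence_const_smul (hus.isContDiff (by simp)), h.divFree (lam * t) (mem_univ _) x, mul_zero]

/-- Periodicity rescales: `τ ↦ τ/λ`. -/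
theorem periodic_timeRescale (hper : Function.Periodic u τ) (hl : lam ≠ 0) :
    Function.Periodic (fun t x => lam • u (lam * t) x) (τ / lam) := by
  intro t
  funext x
  simp only
  rw [mul_add, mul_div_cancel₀ τ hl, hper]

/-- `gradNormSq (λ v) = λ² gradNormSq v` for smooth `v`. -/
theorem gradNormSq_const_smul {v : (UnitAddTorus (Fin 3)) → (EuclideanSpace ℝ (Fin 3))} (hv : Torus.IsSmooth v) (a : ℝ) :
    Torus.gradNormSq (a • v) = a ^ 2 * Torus.gradNormSq v := by
  unfold Torus.gradNormSq
  rw [← integral_const_mul]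
  refine integral_congr_ae (ae_of_all _ fun x => ?_)
  dsimp only
  rw [Finset.mul_sum]
  refine Finset.sum_congr rfl fun i _ => ?_
  rw [Torus.partialDeriv_const_smul (hv.isContDiff (by simp)), Pi.smul_apply, norm_smul, mul_pow,
    Real.norm_eq_abs, sq_abs]

/-- Mean energy rescales by `λ²`. -/
theorem meanEnergy_timeRescale (hper : Function.Periodic u τ) (hτ : 0 < τ) (hl : 0 < lam) :
    meanEnergy (fun t x => lam • u (lam * t) x) = lam ^ 2 * meanEnergy u := by
  rw [meanEnergy_eq_period_mean (periodic_timeRescale hper hl.ne') (div_pos hτ hl), meanEnergy_eq_period_mean hper hτ]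
  have hsub : ∫ t in (0 : ℝ)..τ / lam, ∫ x, ‖lam • u (lam * t) x‖ ^ 2 =
      lam⁻¹ * (lam ^ 2 * ∫ t in (0 : ℝ)..τ, ∫ x, ‖u t x‖ ^ 2) := by
    have h1 : (fun t => ∫ x, ‖lam • u (lam * t) x‖ ^ 2) = fun t => lam ^ 2 * (fun s => ∫ x, ‖u s x‖ ^ 2) (lam * t) := by
      funext t
      simp only
      rw [← integral_const_mul]
      refine integral_congr_ae (ae_of_all _ fun x => ?_)
      dsimp only
      rw [norm_smul, mul_pow, Real.norm_eq_abs, sq_abs]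
    rw [h1, intervalIntegral.integral_const_mul,
      intervalIntegral.integral_comp_mul_left (fun s => ∫ x, ‖u s x‖ ^ 2) hl.ne', mul_zero, mul_div_cancel₀ τ hl.ne',
      smul_eq_mul]
    ring
  rw [hsub]
  field_simp

/-- Mean dissipation rescales by `λ³` (viscosity `λν`). -/
theorem meanDissipation_timeRescale (hu : Torus.IsSmoothSpaceTimeOn univ u) (hper : Function.Periodic u τ)
    (hτ : 0 < τ) (hl : 0 < lam) :
    meanDissipation (lam * ν) (fun t x => lam • u (lam * t) x) = lam ^ 3 * meanDissipation ν u := by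
  have hφ : ContDiff ℝ ((⊤ : ℕ∞) : WithTop ℕ∞) (fun z : ℝ × EuclideanSpace ℝ (Fin 3) => ((lam * z.1, z.2) : ℝ × EuclideanSpace ℝ (Fin 3))) :=
    (contDiff_const.mul contDiff_fst).prodMk contDiff_snd
  have hul : Torus.IsSmoothSpaceTimeOn univ (fun t x => lam • u (lam * t) x) :=
    (hu.comp hφ.contDiffOn (fun z _ => mk_mem_prod (mem_univ _) (mem_univ _))).const_smul lam
  rw [meanDissipation_eq_period_mean hul (periodic_timeRescale hper hl.ne') (div_pos hτ hl),
    meanDissipation_eq_period_mean hu hper hτ]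
  have hsub : ∫ t in (0 : ℝ)..τ / lam, Torus.gradNormSq (fun x => lam • u (lam * t) x) =
      lam⁻¹ * (lam ^ 2 * ∫ t in (0 : ℝ)..τ, Torus.gradNormSq (u t)) := by
    have h1 : (fun t => Torus.gradNormSq (fun x => lam • u (lam * t) x)) =
        fun t => lam ^ 2 * (fun s => Torus.gradNormSq (u s)) (lam * t) := by
      funext t
      exact gradNormSq_const_smul (hu.isSmooth_slice (mem_univ _)) lam
    rw [h1, intervalIntegral.integral_const_mul,
      intervalIntegral.integral_comp_mul_left (fun s => Torus.gradNormSq (u s)) hl.ne', mul_zero,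
      mul_div_cancel₀ τ hl.ne', smul_eq_mul]
    ring
  rw [hsub]
  field_simp

/-- The designer force is real-linear in the coefficient vector: `f_{a c} = a f_c`. -/
theorem force_smul (S : Finset (Fin 3 → ℤ)) (a : ℝ) (c : ↥S → (EuclideanSpace ℂ (Fin 3))) : force S (a • c) = a • force S c := by
  unfold force
  have hcoef : (fun k => Torus.lerayCoeff k (Torus.coeffExt S (a • c) k)) =
      a • fun k => Torus.lerayCoeff k (Torus.coeffExt S c k) := by
    funext k
    rw [Torus.coeffExt_smul, Pi.smul_apply, Pi.smul_apply]
    by_cases hk : k = 0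
    · subst hk; simp
    · rw [Torus.lerayCoeff_of_ne_zero hk, Torus.lerayCoeff_of_ne_zero hk, Torus.leraySym_real_smul]
  rw [hcoef]
  funext x
  set g : (Fin 3 → ℤ) → (EuclideanSpace ℂ (Fin 3)) := fun k => Torus.lerayCoeff k (Torus.coeffExt S c k) with hg
  have ht : Torus.trigPoly S (a • g) x = a • Torus.trigPoly S g x := by
    simp only [Torus.trigPoly_apply, Pi.smul_apply, Finset.smul_sum]
    refine Finset.sum_congr rfl fun k _ => ?_
    rw [smul_comm]
  rw [Torus.realTrigPoly_apply, ht, map_smul, Pi.smul_apply, Torus.realTrigPoly_apply]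

/-- LOUD AT A GIVEN VISCOSITY: `c` carries a periodic classical NS_ν orbit with budgets `(E, ε)`. -/
def LoudAt (S : Finset (Fin 3 → ℤ)) (ν E ε : ℝ) (c : ↥S → (EuclideanSpace ℂ (Fin 3))) : Prop :=
  ∃ (τ : ℝ) (u : ℝ → (UnitAddTorus (Fin 3)) → (EuclideanSpace ℝ (Fin 3))) (p : ℝ → (UnitAddTorus (Fin 3)) → ℝ), 0 < τ ∧
    Torus.IsClassicalNSSolutionOn Set.univ ν (fun _ => force S c) u p ∧
    Function.Periodic u τ ∧ meanEnergy u ≤ E ∧ ε ≤ meanDissipation ν u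

/-- `LOUD_j = ⋃_{0<ν<1/(j+1)} LoudAt ν` (definitional). -/
theorem mem_loudSet_iff_loudAt {S : Finset (Fin 3 → ℤ)} {E ε : ℝ} {j : ℕ} {c : ↥S → (EuclideanSpace ℂ (Fin 3))} :
    c ∈ loudSet S E ε j ↔ ∃ ν : ℝ, 0 < ν ∧ ν < 1 / ((j : ℝ) + 1) ∧ LoudAt S ν E ε c :=
  Iff.rfl

/-- LOUDNESS IS SCALE-COVARIANT: loud at `ν` with budgets `(E,ε)` ⇒ `λ²c` loud at `λν` with `(λ²E, λ³ε)`. -/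
theorem loudAt_timeRescale {S : Finset (Fin 3 → ℤ)} {E ε : ℝ} {c : ↥S → (EuclideanSpace ℂ (Fin 3))} (hl : 0 < lam)
    (h : LoudAt S ν E ε c) : LoudAt S (lam * ν) (lam ^ 2 * E) (lam ^ 3 * ε) (lam ^ 2 • c) := by
  obtain ⟨τ, u, p, hτ, hsol, hper, hE, hε⟩ := h
  refine ⟨τ / lam, fun t x => lam • u (lam * t) x, fun t x => lam ^ 2 * p (lam * t) x, div_pos hτ hl, ?_,
    periodic_timeRescale hper hl.ne', ?_, ?_⟩
  · have := timeRescale hsol lam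
    rwa [force_smul]
  · rw [meanEnergy_timeRescale hper hτ hl]
    exact mul_le_mul_of_nonneg_left hE (sq_nonneg _)
  · rw [meanDissipation_timeRescale hsol.smooth_velocity hper hτ hl]
    exact mul_le_mul_of_nonneg_left hε (pow_nonneg hl.le 3)

/-- … and conversely (rescale back by `λ⁻¹`): an equivalence. -/
theorem loudAt_iff_timeRescale {S : Finset (Fin 3 → ℤ)} {E ε : ℝ} {c : ↥S → (EuclideanSpace ℂ (Fin 3))} (hl : 0 < lam) :
    LoudAt S ν E ε c ↔ LoudAt S (lam * ν) (lam ^ 2 * E) (lam ^ 3 * ε) (lam ^ 2 • c) := by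
  refine ⟨loudAt_timeRescale hl, fun h => ?_⟩
  have h' := loudAt_timeRescale (inv_pos.2 hl) h
  have hl0 : lam ≠ 0 := hl.ne'
  have e1 : lam⁻¹ * (lam * ν) = ν := by field_simp
  have e2 : lam⁻¹ ^ 2 * (lam ^ 2 * E) = E := by field_simp
  have e3 : lam⁻¹ ^ 3 * (lam ^ 3 * ε) = ε := by field_simp
  have e4 : lam⁻¹ ^ 2 • (lam ^ 2 • c) = c := by rw [smul_smul]; field_simp; exact one_smul _ _
  rwa [e1, e2, e3, e4] at h'

/-- GRASHOF (UNIT-VISCOSITY) FORM OF THE LOUD SETS: `c ∈ LOUD_j(S,E,ε)` iff for some `ν ∈ (0, 1/(j+1))` the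
force `ν⁻² c` is loud AT VISCOSITY ONE with budgets `(E/ν², ε/ν³)`. -/
theorem mem_loudSet_iff_unit_viscosity {S : Finset (Fin 3 → ℤ)} {E ε : ℝ} {j : ℕ} {c : ↥S → (EuclideanSpace ℂ (Fin 3))} :
    c ∈ loudSet S E ε j ↔
      ∃ ν : ℝ, 0 < ν ∧ ν < 1 / ((j : ℝ) + 1) ∧ LoudAt S 1 (E / ν ^ 2) (ε / ν ^ 3) ((ν ^ 2)⁻¹ • c) := by
  rw [mem_loudSet_iff_loudAt]
  refine exists_congr fun ν => and_congr_right fun hν => and_congr_right fun _ => ?_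
  rw [loudAt_iff_timeRescale (lam := ν⁻¹) (inv_pos.2 hν)]
  have hν0 : ν ≠ 0 := hν.ne'
  have e1 : ν⁻¹ * ν = 1 := by field_simp
  have e2 : ν⁻¹ ^ 2 * E = E / ν ^ 2 := by field_simp
  have e3 : ν⁻¹ ^ 3 * ε = ε / ν ^ 3 := by field_simp
  have e4 : ν⁻¹ ^ 2 = (ν ^ 2)⁻¹ := by rw [inv_pow]
  rw [e1, e2, e3, e4]

end Scaling

end Summit.AnomalousDissipation.AnomalousDissipation.Theorems.DenseLoudDesignerForces.Negative

end
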